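import Mathlib
import Summits.Ventures.HodgeRepro.Tier4.Common.AdelicDefs

/-!
# Tier4/Common/AdelicPlaces — the place decomposition of the adelic unitary group: local components at the finite
and infinite places, the maximal compact subgroups `K_v`, supports away from a place, right invariance, the
convolution and the «`e` is an idempotent for `f`» predicate (Adelic v0.5, t4-plan-1 S12125 (5))

Blind re-derivation cell `pub-hodge-repro`, Tier 4 (README §9–§10), seat t4-typer-2 (gen 0).  Target tree path
`lean/Summits/Ventures/HodgeRepro/Tier4/Common/AdelicPlaces.lean`.  Imports `Tier4/Common/AdelicDefs.lean` (the
defined `GA W ≤ GL₄(𝔸_k)`).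

WHAT IS DEFINED (Mathlib only).  The adele ring is `𝔸_k = (∏_{w | ∞} k_w) × (Πʳ_v k_v)`; its components are ring
homomorphisms (`adComponentFin v : 𝔸_k →+* k_v` = `RestrictedProduct.evalRingHom ∘ snd`, `adComponentInf w : 𝔸_k
→+* k_w` = `Pi.evalRingHom ∘ fst`), hence group homomorphisms of the matrix groups (`Matrix.GeneralLinearGroup.map`)
and of the defined `GA W` (`GA.finiteComponent W v : GA W →* GL (Fin 4) k_v`, `GA.infiniteComponent W w`).  On top:
* `IsIntegralAt v g` — `g ∈ GL₄(𝒪_v)` (entries of `g` and of `g⁻¹` in `adicCompletionIntegers`); `maximalCompactAt W v :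
  Subgroup (GA W)` — the preimage `K_v = G(𝔸_k) ∩ (GL₄(𝒪_v) at v)`, the hyperspecial-type compact open of the line;
* `SupportedInMaximalCompactAwayFrom W v₀ e` — «`e` is supported in `K^{v₀} × U′`»: every `g` in the support of `e`
  lies in `K_v` for every finite `v ≠ v₀` (nothing is asked at `v₀` or at infinity — the line's `U′` is whatever
  `e` does there);
* `RightInvariantUnder K f` — `f (g κ) = f g` for `κ ∈ K` (the `S`-components of `f` are `K_S`-invariant: «pure
  tensor with prescribed `S`-components» in the only form the integrals see);
* `conv μ e f x := ∫ y, e y * f (y⁻¹ x) ∂μ` and **`IsIdempotentFor μ e f := conv μ e f = f`** — the DEFINED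
  hypothesis «the admissible projector `e_S` fixes `f₁`» (t4-plan-1's F2′), with the Haar measure as a parameter
  (Mathlib's `IsHaarMeasure` is the predicate a line states on it, AdelicRTF).

Nothing here is a theorem about the intended objects; nothing here says anything about the status of the Hodge
conjecture for CM abelian varieties, which is NOT proved (HC_CM is NOT proved by anyone in this repository).
-/

set_option autoImplicit false

noncomputable section

namespace Summit.Ventures.HodgeRepro.Tier4.Common

open NumberField Matrix IsDedekindDomain
open scoped NumberField

section Components

variable (k : Type) [Field k] [NumberField k]

/-- The projection of the adele ring to its component at a finite place `v` (a ring homomorphism). -/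
def adComponentFin (v : HeightOneSpectrum (𝓞 k)) : Ad k →+* v.adicCompletion k :=
  (RestrictedProduct.evalRingHom (fun v : HeightOneSpectrum (𝓞 k) => v.adicCompletion k) v).comp
    (RingHom.snd (InfiniteAdeleRing k) (FiniteAdeleRing (𝓞 k) k))

/-- The projection of the adele ring to its component at an infinite place `w`. -/
def adComponentInf (w : InfinitePlace k) : Ad k →+* w.Completion :=
  (Pi.evalRingHom (fun w : InfinitePlace k => w.Completion) w).comp
    (RingHom.fst (InfiniteAdeleRing k) (FiniteAdeleRing (𝓞 k) k))

/-- The component at `v` of a principal adele is the element itself (in `k_v`). -/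
theorem adComponentFin_algebraMap (v : HeightOneSpectrum (𝓞 k)) (x : k) :
    adComponentFin k v (algebraMap k (Ad k) x) = algebraMap k (v.adicCompletion k) x := rfl

/-- The projection `GL₄(𝔸_k) → GL₄(k_v)`. -/
def GL4.finiteComponent (v : HeightOneSpectrum (𝓞 k)) : GL4 k →* GL (Fin 4) (v.adicCompletion k) :=
  Matrix.GeneralLinearGroup.map (adComponentFin k v)

/-- The projection `GL₄(𝔸_k) → GL₄(k_w)` at an infinite place. -/
def GL4.infiniteComponent (w : InfinitePlace k) : GL4 k →* GL (Fin 4) w.Completion :=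
  Matrix.GeneralLinearGroup.map (adComponentInf k w)

variable {k} (W : PlaneData k)

/-- **The local component at a finite place** of the adelic unitary group: `G(𝔸_k) → GL₄(k_v)`. -/
def GA.finiteComponent (v : HeightOneSpectrum (𝓞 k)) : GA W →* GL (Fin 4) (v.adicCompletion k) :=
  (GL4.finiteComponent k v).comp (unitaryGroup W).subtype

/-- **The local component at an infinite place**. -/
def GA.infiniteComponent (w : InfinitePlace k) : GA W →* GL (Fin 4) w.Completion :=
  (GL4.infiniteComponent k w).comp (unitaryGroup W).subtype

/-- The entries of the `v`-component of `g` are the `v`-components of the entries. -/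
theorem GA.finiteComponent_apply (v : HeightOneSpectrum (𝓞 k)) (g : GA W) (i j : Fin 4) :
    ((GA.finiteComponent W v g : GL (Fin 4) (v.adicCompletion k)) : Matrix (Fin 4) (Fin 4) (v.adicCompletion k)) i j =
      adComponentFin k v (GA.mat W g i j) := rfl

end Components

section Compact

variable {k : Type} [Field k] [NumberField k] (W : PlaneData k)

/-- `g ∈ GL₄(𝒪_v)`: the entries of `g` and of `g⁻¹` are `v`-integral. -/
def IsIntegralAt (v : HeightOneSpectrum (𝓞 k)) (g : GL (Fin 4) (v.adicCompletion k)) : Prop :=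
  (∀ i j, ((g : GL (Fin 4) (v.adicCompletion k)) : Matrix (Fin 4) (Fin 4) (v.adicCompletion k)) i j ∈
      v.adicCompletionIntegers k) ∧
    (∀ i j, ((g⁻¹ : GL (Fin 4) (v.adicCompletion k)) : Matrix (Fin 4) (Fin 4) (v.adicCompletion k)) i j ∈
      v.adicCompletionIntegers k)

/-- Products of `v`-integral matrices are `v`-integral (entrywise: sums of products in the subring). -/
theorem mem_adicCompletionIntegers_mul_apply (v : HeightOneSpectrum (𝓞 k))
    {A B : Matrix (Fin 4) (Fin 4) (v.adicCompletion k)}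
    (hA : ∀ i j, A i j ∈ v.adicCompletionIntegers k) (hB : ∀ i j, B i j ∈ v.adicCompletionIntegers k) (i j : Fin 4) :
    (A * B) i j ∈ v.adicCompletionIntegers k := by
  rw [Matrix.mul_apply]
  exact Subring.sum_mem _ fun l _ => Subring.mul_mem _ (hA i l) (hB l j)

/-- The identity is `v`-integral. -/
theorem isIntegralAt_one (v : HeightOneSpectrum (𝓞 k)) : IsIntegralAt v (1 : GL (Fin 4) (v.adicCompletion k)) := by
  refine ⟨fun i j => ?_, fun i j => ?_⟩ <;> simp only [inv_one, Units.val_one, Matrix.one_apply] <;> split_ifs <;>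
    simp

/-- `v`-integrality is closed under products. -/
theorem IsIntegralAt.mul (v : HeightOneSpectrum (𝓞 k)) {g h : GL (Fin 4) (v.adicCompletion k)}
    (hg : IsIntegralAt v g) (hh : IsIntegralAt v h) : IsIntegralAt v (g * h) := by
  refine ⟨fun i j => ?_, fun i j => ?_⟩
  · rw [Units.val_mul]
    exact mem_adicCompletionIntegers_mul_apply v hg.1 hh.1 i j
  · rw [_root_.mul_inv_rev, Units.val_mul]
    exact mem_adicCompletionIntegers_mul_apply v hh.2 hg.2 i j

/-- `v`-integrality is closed under inverses. -/
theorem IsIntegralAt.inv (v : HeightOneSpectrum (𝓞 k)) {g : GL (Fin 4) (v.adicCompletion k)}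
    (hg : IsIntegralAt v g) : IsIntegralAt v g⁻¹ := by
  refine ⟨hg.2, ?_⟩
  rw [inv_inv]
  exact hg.1

/-- **The maximal compact subgroup at `v`**: `K_v = {g ∈ G(𝔸_k) | g_v ∈ GL₄(𝒪_v)}`. -/
def maximalCompactAt (v : HeightOneSpectrum (𝓞 k)) : Subgroup (GA W) where
  carrier := {g | IsIntegralAt v (GA.finiteComponent W v g)}
  one_mem' := by
    show IsIntegralAt v (GA.finiteComponent W v 1)
    rw [map_one]
    exact isIntegralAt_one v
  mul_mem' := by
    intro g h hg hh
    show IsIntegralAt v (GA.finiteComponent W v (g * h))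
    rw [map_mul]
    exact IsIntegralAt.mul v hg hh
  inv_mem' := by
    intro g hg
    show IsIntegralAt v (GA.finiteComponent W v g⁻¹)
    rw [map_inv]
    exact IsIntegralAt.inv v hg

/-- Membership in `K_v` unfolded. -/
theorem mem_maximalCompactAt (v : HeightOneSpectrum (𝓞 k)) (g : GA W) :
    g ∈ maximalCompactAt W v ↔ IsIntegralAt v (GA.finiteComponent W v g) := Iff.rfl

end Compact

section TestFunctions

open MeasureTheory

variable {k : Type} [Field k] [NumberField k] (W : PlaneData k)

/-- **`e` is supported in `K^{v₀} × U′`**: every point of its support lies in `K_v` for every finite `v ≠ v₀`. -/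
def SupportedInMaximalCompactAwayFrom (v₀ : HeightOneSpectrum (𝓞 k)) (e : GA W → ℂ) : Prop :=
  ∀ g : GA W, e g ≠ 0 → ∀ v : HeightOneSpectrum (𝓞 k), v ≠ v₀ → g ∈ maximalCompactAt W v

/-- `f` is right-invariant under the subgroup `K`: `f (g κ) = f g` for `κ ∈ K` (the shape of «`f` has prescribed,
`K`-fixed components»). -/
def RightInvariantUnder (K : Subgroup (GA W)) (f : GA W → ℂ) : Prop := ∀ g : GA W, ∀ κ ∈ K, f (g * κ) = f g

/-- `f` is left-invariant under `K`. -/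
def LeftInvariantUnder (K : Subgroup (GA W)) (f : GA W → ℂ) : Prop := ∀ g : GA W, ∀ κ ∈ K, f (κ * g) = f g

variable [MeasurableSpace (GA W)]

/-- **The convolution** `(e ∗ f)(x) = ∫ e(y) f(y⁻¹ x) dμ(y)` for a measure `μ` on `G(𝔸_k)`. -/
def conv (μ : Measure (GA W)) (e f : GA W → ℂ) (x : GA W) : ℂ := ∫ y, e y * f (y⁻¹ * x) ∂μ

/-- **`e` is an idempotent for `f`**: `e ∗ f = f` — the DEFINED form of «the admissible projector `e_S` fixes `f₁`». -/
def IsIdempotentFor (μ : Measure (GA W)) (e f : GA W → ℂ) : Prop := conv W μ e f = f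

/-- `e` is an idempotent: `e ∗ e = e`. -/
def IsIdempotent (μ : Measure (GA W)) (e : GA W → ℂ) : Prop := conv W μ e e = e

/-- `IsIdempotentFor` unfolded pointwise. -/
theorem isIdempotentFor_iff (μ : Measure (GA W)) (e f : GA W → ℂ) :
    IsIdempotentFor W μ e f ↔ ∀ x, ∫ y, e y * f (y⁻¹ * x) ∂μ = f x := by
  unfold IsIdempotentFor conv
  exact funext_iff

end TestFunctions

end Summit.Ventures.HodgeRepro.Tier4.Common

end
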